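import Mathlib
import Literature.Analysis.FluidPDE.VectorCalculus

/-!
# Route RotatingEulerWindowProfile — BC5 rung for the deciding crux `RotatingWindowProfileExists`
(item stmt-NavierStokesRegularity-19865): an explicit linear inhabitant of the rotated profile clause block
minus its far-field tail

The deciding crux of `Theses/RotatingEulerWindowProfile.lean` asks for a C² solution `(β, α, e, U, Ω)` of the
ROTATED similarity-profile system of 3D Euler — momentum form
`(1-β) U + α e×U + DU·(β(y-c) - α e×(y-c) + U) + ∇P = 0`, vorticity form
`DΩ·V - DU·Ω = -Ω - α e×Ω`, `div U = 0`, `m Ω = curl U`, global Lipschitz bounds, `‖Ω 0‖ = 1` — with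
`α ≠ 0`, `2/5 ≤ β < 1/2` AND the marginal far-field decay `|Ω| ≲ ⟨y⟩^{-1/β}`, `|U| ≲ ⟨y⟩^{1-1/β}`.

This cycle-free file (it does not import the route) proves that EVERY clause except the decay is satisfied,
for every `β` in the window and every angular speed `α` (in particular `α ≠ 0`), by the explicit
NON-EQUIVARIANT linear profile about the axis `e = e₂`
`U = A_α y`, `A_α = [[1, α, 0], [α, 0, -1/2], [0, 1/2, -1]]` (trace `0`, `curl U ≡ e₀`), `Ω ≡ e₀`, `m = 1`, `c = 0`,
`P(y) = -½ ⟨y, M_α y⟩`, `M_α = A_α + α (J A_α - A_α J) + A_α² = [[2-α², 3α, 0], [3α, 3α²-1/4, 0], [0, 0, -1/4]]`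
(`J = e₂ × ·`). The α-terms are active (`alpha_terms_active`: `[J, A_α] e₀ ≠ 0`), so the rotated sign
conventions of the clause block are exercised, and any refutation of the crux must use the tail conjunct —
exactly the Chae-marginal decay `k = 1/β` where no Liouville theorem is available for `α ≠ 0`
(Pineau–Vicol 2026, p. 4; Chae 2015, Thm 1.1 needs `k > 1/β`). Linear (stagnation-type) profiles are exact
infinite-energy self-similar Euler blow-ups `u = (T-t)^{β-1} R U(R⁻¹(x-x₀)/(T-t)^β)`, a regime about which the
Clay statement says nothing: the rung lies outside the summit's known regime.

Main statement: `rotatingEulerWindowProfile_linearRung` (the crux block verbatim with the decay conjunct removed and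
`α ≠ 0` dropped from the hypotheses because the witness works for all `α`).
-/

open Literature.Analysis.FluidPDE InnerProductSpace
open scoped RealInnerProductSpace

namespace Summit.NavierStokesRegularity.NavierStokesRegularity.Theorems

namespace RotatingEulerWindowProfileLinearRung

noncomputable section

/-- `ℝ³`. -/
abbrev E3 := EuclideanSpace ℝ (Fin 3)

/-- basis vector `e₀`. -/
def e0 : E3 := EuclideanSpace.single 0 1
/-- basis vector `e₁`. -/
def e1 : E3 := EuclideanSpace.single 1 1
/-- basis vector `e₂` (the rotation axis). -/
def e2 : E3 := EuclideanSpace.single 2 1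



/-- The linear profile `A_α`. -/
def A (α : ℝ) : E3 →L[ℝ] E3 :=
  (EuclideanSpace.proj 0).smulRight e0 + α • (EuclideanSpace.proj 1).smulRight e0
  + α • (EuclideanSpace.proj 0).smulRight e1 + (-(1/2 : ℝ)) • (EuclideanSpace.proj 2).smulRight e1
  + (1/2 : ℝ) • (EuclideanSpace.proj 1).smulRight e2 + (-1 : ℝ) • (EuclideanSpace.proj 2).smulRight e2

/-- the three coordinates of `A_α y`. -/
theorem A_apply_coord (α : ℝ) (y : E3) (i : Fin 3) :
    A α y i = if i = 0 then y 0 + α * y 1 else if i = 1 then α * y 0 - (1/2) * y 2 else (1/2) * y 1 - y 2 := by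
  fin_cases i <;> simp [A, e0, e1, e2] <;> ring

/-- `(A_α y)₀ = y₀ + α y₁`. -/
@[simp] theorem A_apply_zero (α : ℝ) (y : E3) : A α y 0 = y 0 + α * y 1 := by
  simpa using A_apply_coord α y 0
/-- `(A_α y)₁ = α y₀ - y₂/2`. -/
@[simp] theorem A_apply_one (α : ℝ) (y : E3) : A α y 1 = α * y 0 - (1/2) * y 2 := by
  simpa using A_apply_coord α y 1
/-- `(A_α y)₂ = y₁/2 - y₂`. -/
@[simp] theorem A_apply_two (α : ℝ) (y : E3) : A α y 2 = (1/2) * y 1 - y 2 := by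
  simpa using A_apply_coord α y 2

/-- coordinates of the cross product -/
@[simp] theorem cross_apply_zero (v w : E3) : cross v w 0 = v 1 * w 2 - v 2 * w 1 := by
  simp [cross, cross_apply]
/-- second coordinate of the cross product. -/
@[simp] theorem cross_apply_one (v w : E3) : cross v w 1 = v 2 * w 0 - v 0 * w 2 := by
  simp [cross, cross_apply]
/-- third coordinate of the cross product. -/
@[simp] theorem cross_apply_two (v w : E3) : cross v w 2 = v 0 * w 1 - v 1 * w 0 := by
  simp [cross, cross_apply]

/-- The pressure `P_α(y) = -½ ⟨y, M_α y⟩`, written as a polynomial in the coordinates. -/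
def P (α : ℝ) (y : E3) : ℝ :=
  -(1/2 : ℝ) * ((2 - α ^ 2) * (y 0) ^ 2 + 6 * α * (y 0 * y 1) + (3 * α ^ 2 - 1/4) * (y 1) ^ 2
    - (1/4) * (y 2) ^ 2)

/-- Its gradient `-M_α y`. -/
def gradP (α : ℝ) (y : E3) : E3 :=
  (-((2 - α ^ 2) * y 0 + 3 * α * y 1)) • e0 + (-(3 * α * y 0 + (3 * α ^ 2 - 1/4) * y 1)) • e1
    + ((1/4) * y 2) • e2

/-- the coordinate functions are `C^∞` / have the obvious derivative -/
theorem hasFDerivAt_coord (i : Fin 3) (y : E3) :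
    HasFDerivAt (fun z : E3 => z i) (EuclideanSpace.proj i : E3 →L[ℝ] ℝ) y :=
  (EuclideanSpace.proj i : E3 →L[ℝ] ℝ).hasFDerivAt

/-- the Fréchet derivative of the quadratic pressure, as a combination of coordinate projections. -/
theorem hasFDerivAt_P (α : ℝ) (y : E3) :
    HasFDerivAt (P α)
      (-(1/2 : ℝ) • ((2 - α ^ 2) • ((2 * y 0) • (EuclideanSpace.proj 0 : E3 →L[ℝ] ℝ))
        + (6 * α) • ((y 0) • (EuclideanSpace.proj 1 : E3 →L[ℝ] ℝ) + (y 1) • (EuclideanSpace.proj 0 : E3 →L[ℝ] ℝ))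
        + (3 * α ^ 2 - 1/4) • ((2 * y 1) • (EuclideanSpace.proj 1 : E3 →L[ℝ] ℝ))
        - (1/4 : ℝ) • ((2 * y 2) • (EuclideanSpace.proj 2 : E3 →L[ℝ] ℝ)))) y := by
  have h0 := hasFDerivAt_coord 0 y
  have h1 := hasFDerivAt_coord 1 y
  have h2 := hasFDerivAt_coord 2 y
  have hsq0 : HasFDerivAt (fun z : E3 => z 0 ^ 2) ((2 * y 0) • (EuclideanSpace.proj 0 : E3 →L[ℝ] ℝ)) y := by
    simpa using h0.pow 2
  have hsq1 : HasFDerivAt (fun z : E3 => z 1 ^ 2) ((2 * y 1) • (EuclideanSpace.proj 1 : E3 →L[ℝ] ℝ)) y := by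
    simpa using h1.pow 2
  have hsq2 : HasFDerivAt (fun z : E3 => z 2 ^ 2) ((2 * y 2) • (EuclideanSpace.proj 2 : E3 →L[ℝ] ℝ)) y := by
    simpa using h2.pow 2
  have hprod : HasFDerivAt (fun z : E3 => z 0 * z 1)
      ((y 0) • (EuclideanSpace.proj 1 : E3 →L[ℝ] ℝ) + (y 1) • (EuclideanSpace.proj 0 : E3 →L[ℝ] ℝ)) y := by
    simpa using h0.fun_mul h1
  unfold P
  exact ((((hsq0.const_mul _).fun_add (hprod.const_mul _)).fun_add (hsq1.const_mul _)).fun_sub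
    (hsq2.const_mul _)).const_mul _

/-- that derivative is the dual of `gradP α y = -M_α y`. -/
theorem fderiv_P_eq_toDual (α : ℝ) (y : E3) :
    (-(1/2 : ℝ) • ((2 - α ^ 2) • ((2 * y 0) • (EuclideanSpace.proj 0 : E3 →L[ℝ] ℝ))
        + (6 * α) • ((y 0) • (EuclideanSpace.proj 1 : E3 →L[ℝ] ℝ) + (y 1) • (EuclideanSpace.proj 0 : E3 →L[ℝ] ℝ))
        + (3 * α ^ 2 - 1/4) • ((2 * y 1) • (EuclideanSpace.proj 1 : E3 →L[ℝ] ℝ))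
        - (1/4 : ℝ) • ((2 * y 2) • (EuclideanSpace.proj 2 : E3 →L[ℝ] ℝ))))
      = InnerProductSpace.toDual ℝ E3 (gradP α y) := by
  refine ContinuousLinearMap.ext fun v => ?_
  simp only [InnerProductSpace.toDual_apply_apply]
  simp only [gradP, e0, e1, e2, inner_add_left, real_inner_smul_left, EuclideanSpace.inner_single_left,
    map_one, one_mul, smul_apply, add_apply,
    sub_apply, PiLp.proj_apply, smul_eq_mul]
  ring

/-- `∇P_α(y) = -M_α y`. -/
theorem hasGradientAt_P (α : ℝ) (y : E3) : HasGradientAt (P α) (gradP α y) y := by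
  rw [hasGradientAt_iff_hasFDerivAt]
  exact (hasFDerivAt_P α y).congr_fderiv (fderiv_P_eq_toDual α y)

/-- `gradient (P α) y = gradP α y`. -/
theorem gradient_P (α : ℝ) (y : E3) : gradient (P α) y = gradP α y :=
  (hasGradientAt_P α y).gradient

/-- the pressure is `C¹` (indeed polynomial). -/
theorem contDiff_P (α : ℝ) : ContDiff ℝ 1 (P α) := by
  unfold P
  fun_prop

/-- first coordinate of `gradP`. -/
@[simp] theorem gradP_apply_zero (α : ℝ) (y : E3) : gradP α y 0 = -((2 - α ^ 2) * y 0 + 3 * α * y 1) := by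
  simp [gradP, e0, e1, e2]
/-- second coordinate of `gradP`. -/
@[simp] theorem gradP_apply_one (α : ℝ) (y : E3) : gradP α y 1 = -(3 * α * y 0 + (3 * α ^ 2 - 1/4) * y 1) := by
  simp [gradP, e0, e1, e2]
/-- third coordinate of `gradP`. -/
@[simp] theorem gradP_apply_two (α : ℝ) (y : E3) : gradP α y 2 = (1/4) * y 2 := by
  simp [gradP, e0, e1, e2]

/-- `curl A_α ≡ e₀` -/
theorem curl_A (α : ℝ) (y : E3) : curl (A α) y = e0 := by
  ext i
  fin_cases i <;> simp [curl, ContinuousLinearMap.fderiv, e0]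
  norm_num

/-- `div A_α ≡ 0` -/
theorem isDivFree_A (α : ℝ) : VectorCalculus.IsDivFree (A α : E3 → E3) := by
  intro x
  rw [divergence_eq_sum_inner_fderiv (EuclideanSpace.basisFun (Fin 3) ℝ)]
  simp [Fin.sum_univ_three, ContinuousLinearMap.fderiv, EuclideanSpace.inner_single_left]

/-- the α-terms of the rotated block do NOT cancel on this profile (`[J, A_α] e₀ = -2α e₀ + e₁ - ½ e₂ ≠ 0`) -/
theorem alpha_terms_active (α : ℝ) : cross e2 (A α e0) - A α (cross e2 e0) ≠ 0 := by
  intro h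
  have := congrArg (fun v : E3 => v 1) h
  simp [e0, e2] at this

/-- **BC5 rung.** The rotated similarity-profile clause block of `RotatingWindowProfileExists`
minus its far-field decay conjunct is inhabited, for every exponent in the window and every angular
speed `α`, by the explicit linear profile `A_α` about the axis `e₂` with constant vorticity `e₀`. -/
theorem linearRung :
    ∀ β α : ℝ, (2 / 5 : ℝ) ≤ β → β < 1 / 2 → ∃ (e : EuclideanSpace ℝ (Fin 3)) (U Ω : EuclideanSpace ℝ (Fin 3) → EuclideanSpace ℝ (Fin 3)), ‖e‖ = 1 ∧ ((2 / 5 : ℝ) ≤ β ∧ β < 1 / 2 ∧ ContDiff ℝ 2 U ∧ ContDiff ℝ 1 Ω ∧ Literature.Analysis.FluidPDE.VectorCalculus.IsDivFree U ∧ (∃ m : ℝ, 0 < m ∧ ∀ y, m • Ω y = Literature.Analysis.FluidPDE.curl U y) ∧ (∃ L : NNReal, LipschitzWith L U ∧ LipschitzWith L Ω) ∧ (∃ (c : EuclideanSpace ℝ (Fin 3)) (P : EuclideanSpace ℝ (Fin 3) → ℝ), ContDiff ℝ 1 P ∧ (∀ y, (1 - β) • U y + α • Literature.Analysis.FluidPDE.cross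 e (U y) + fderiv ℝ U y (β • (y - c) - α • Literature.Analysis.FluidPDE.cross e (y - c) + U y) + gradient P y = 0) ∧ (∀ y, fderiv ℝ Ω y (β • (y - c) - α • Literature.Analysis.FluidPDE.cross e (y - c) + U y) - fderiv ℝ U y (Ω y) = -(Ω y) - α • Literature.Analysis.FluidPDE.cross e (Ω y))) ∧ ‖Ω 0‖ = 1) := by
  intro β α hb1 hb2
  refine ⟨e2, A α, fun _ => e0, by simp [e2], hb1, hb2, (A α).contDiff, contDiff_const, isDivFree_A α,
    ⟨1, one_pos, fun y => by simpa using (curl_A α y).symm⟩, ?_, ⟨0, P α, contDiff_P α, ?_, ?_⟩, by simp [e0]⟩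
  · exact ⟨‖A α‖₊, (A α).lipschitz, LipschitzWith.const' e0⟩
  · intro y
    rw [gradient_P]
    ext i
    fin_cases i <;> simp [ContinuousLinearMap.fderiv, sub_zero, e2] <;> ring
  · intro y
    ext i
    fin_cases i <;> simp [ContinuousLinearMap.fderiv, sub_zero, e0, e2]

end

end RotatingEulerWindowProfileLinearRung

/-- **BC5 rung of route RotatingEulerWindowProfile** (crux `RotatingWindowProfileExists`, item
stmt-NavierStokesRegularity-19865): the rotated similarity-profile clause block minus its far-field decay conjunct is
inhabited for every `2/5 ≤ β < 1/2` and every `α` — see the module docstring for the explicit witness. -/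
theorem rotatingEulerWindowProfile_linearRung :
    ∀ β α : ℝ, (2 / 5 : ℝ) ≤ β → β < 1 / 2 → ∃ (e : EuclideanSpace ℝ (Fin 3)) (U Ω : EuclideanSpace ℝ (Fin 3) → EuclideanSpace ℝ (Fin 3)), ‖e‖ = 1 ∧ ((2 / 5 : ℝ) ≤ β ∧ β < 1 / 2 ∧ ContDiff ℝ 2 U ∧ ContDiff ℝ 1 Ω ∧ Literature.Analysis.FluidPDE.VectorCalculus.IsDivFree U ∧ (∃ m : ℝ, 0 < m ∧ ∀ y, m • Ω y = Literature.Analysis.FluidPDE.curl U y) ∧ (∃ L : NNReal, LipschitzWith L U ∧ LipschitzWith L Ω) ∧ (∃ (c : EuclideanSpace ℝ (Fin 3)) (P : EuclideanSpace ℝ (Fin 3) → ℝ), ContDiff ℝ 1 P ∧ (∀ y, (1 - β) • U y + α • Literature.Analysis.FluidPDE.cross e (U y) + fderiv ℝ U y (β • (y - c) - α • Literature.Analysis.FluidPDE.cross e (y - c) + U y) + gradient P y = 0) ∧ (∀ y, fderiv ℝ Ω y (β • (y - c) - α • Literature.Analysis.FluidPDE.cross e (y - c) + U y) - fderiv ℝ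 U y (Ω y) = -(Ω y) - α • Literature.Analysis.FluidPDE.cross e (Ω y))) ∧ ‖Ω 0‖ = 1) :=
  RotatingEulerWindowProfileLinearRung.linearRung

end Summit.NavierStokesRegularity.NavierStokesRegularity.Theorems
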